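import Literature.AlgebraicGeometry.Hyperkaehler.K3HilbertType
import Literature.AlgebraicGeometry.HodgeTheory.GysinFormalism
import Literature.AlgebraicGeometry.HodgeTheory.RationalHodgeClasses
import Literature.AlgebraicGeometry.HodgeTheory.ChernCharacterBetti
import Literature.AlgebraicGeometry.Surfaces.K3NikulinInvolution
import HarnessLib

/-!
# Mongardi's theorem: the fixed locus of a symplectic involution on a `K3^[2]`-type fourfold is `28` points and one K3 surface — NAMED FACT

Layer `Literature/AlgebraicGeometry/Hyperkaehler`. G. Mongardi, *Symplectic involutions on deformations
of `K3^[2]`*, Cent. Eur. J. Math. 10 (2012) 1472–1485 (arXiv:1107.2854), Theorem 4.1 (§4, PDF p. 8,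
READ): "Let `X` be a Hyperkähler manifold of `K3^[2]`-type with a symplectic involution `φ`. Then
[Camere's conjecture] holds true, the fixed locus `X^φ` consists of 28 isolated points and one K3
surface. Moreover the lattice `T_φ(X)` has rank 15." (with Def. 3.1, p. 6: "`T_G(X)` inside
`H²(X, ℤ)` [is] the fixed locus of the induced action of `G` on cohomology […] the co-invariant locus
`S_G(X)` as `T_G(X)^⊥`"; §1 p. 2: "symplectic involutions, involutions `φ` such that `φ^*(σ) = σ`",
`σ` the holomorphic symplectic form), and Theorem 5.2 (§5, p. 10, READ): "the lattice `S_φ(X)` is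
isomorphic to `E₈(−2)` and `T_φ(X)` is isomorphic to `E₈(−2) ⊕ U³ ⊕ (−2)`".  Consumer: the heart
`HKNikulinTwinClass` of line `hyperkaehler-nikulin-anchors` of crux stmt-HodgeConjecture-13674
(`Cruxes/TwinSimilitudeAlgebraic/Lines/hyperkaehler-nikulin-anchors-heart.md`, fact F2 (a)–(b): the
fixed K3 surface `Σ ↪ X` whose restriction map doubles the Beauville form on `T(X)`,
Camere–Garbagnati–Kapustka–Kapustka 2026 Thm. 5.12), and any line through generalized Nikulin surfaces.

## Rendering (tree carriers) and design

* `X` smooth projective of dimension `4` (`Motives.IsSmoothProjective 4 X`) and of `K3^[2]`-type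
  (`IsOfK3HilbertSquareType X`, file `K3HilbertType`) — Mongardi's hyperkähler manifolds of
  `K3^[2]`-type include the non-projective ones; the projective case is what the algebraic routes use.
* an involution: `ι : X ⟶ X` in `SchemeOver ℂ` with `ι ≫ ι = 𝟙 X` and `ι ≠ 𝟙 X`.
* SYMPLECTIC, read cohomologically: `ι^*` fixes the classes of Hodge type `(2,0)` in `H²(X(ℂ); ℂ)`
  (`HodgeTheory.IsOfHodgeType 4 X 2 2 0`, pull-back `HodgeTheory.complexBetti.map ι 2`).  On an
  irreducible symplectic `X`, `H^{2,0} = ℂ[σ]` and `ι^*σ = ±σ` for the FORM (Mongardi §1), and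
  holomorphic forms inject into cohomology (Hodge theory on the compact Kähler `X(ℂ)`), so
  "`ι^*[τ] = [τ]` for all `(2,0)`-classes `[τ]`" is exactly "`ι^*σ = σ`".
* THE FIXED K3: a K3 surface `Σ` (`Surfaces.IsK3Surface`: projective — a closed subvariety of the
  projective `X`) with a closed immersion `ν : Σ ⟶ X` (`AlgebraicGeometry.IsClosedImmersion ν.left`)
  fixed by `ι` (`ν ≫ ι = ν`), whose complex points are exactly the non-isolated fixed points: the fixed
  points of `ι(ℂ)` (`Motives.AlgPoints.mapContinuous ι`) off `ν(Σ(ℂ))` form a finite set of `28` points.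
* THE INVARIANT RANK: `dim_ℂ {x ∈ H²(X(ℂ); ℂ) | ι^*x = x} = 15` (`= rank T_φ(X)`; over `ℂ` the rank of
  the invariant lattice), out of `b₂ = 23`.  The lattice ISOMETRY classes of Thm. 5.2
  (`S_φ ≅ E₈(−2)`, `T_φ ≅ U³ ⊕ E₈(−2) ⊕ ⟨−2⟩` for the Beauville–Bogomolov form) are NOT rendered here:
  they need the BBF form as a primitive INTEGRAL form on `H²(X, ℤ)` (a marking of `K3^[2]`-type
  manifolds), listed under "Not here" of `K3HilbertType`; the ranks `15 = 3·2 + 8 + 1` and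
  `8 = 23 − 15` are what is stated.

## What is NOT here

Thm. 1.3 (deformation equivalence of `(X, φ)` to a natural `(S^[2], ψ^[2])`); the lattice isometry
classes of Thm. 5.2 (see above); Camere's Prop. 4.2; any proof.

## References

* [Mongardi2011] G. Mongardi, Symplectic involutions on deformations of K3^[2], Cent. Eur. J. Math.
  10 (2012), Thm. 4.1, Thm. 5.2, Def. 3.1, §1.
* [CamereEtAl2026] C. Camere, A. Garbagnati, G. Kapustka, M. Kapustka, Generalized Nikulin surfaces
  and irreducible symplectic fourfolds, arXiv:2607.00130, §5.2 (the restriction map `ν^*`).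
-/

noncomputable section

open CategoryTheory MonoidalCategory

namespace Literature.AlgebraicGeometry.Hyperkaehler

/-- **Mongardi 2012, Thm. 4.1 (with the rank statement of Thm. 4.1 / Thm. 5.2), projective case:
the fixed locus of a symplectic involution on a fourfold of `K3^[2]`-type consists of `28` isolated
points and ONE K3 surface, and the invariant part of `H²` has rank `15`.**  Rendering (module
docstring): for `X` smooth projective of dimension `4` of `K3^[2]`-type and an involution `ι ≠ 𝟙` of
`X` fixing the `(2,0)`-classes of `H²(X(ℂ); ℂ)`, there are a (projective) K3 surface `Σ` and a closed
immersion `ν : Σ ⟶ X` with `ν ≫ ι = ν` such that the fixed points of `ι(ℂ)` not on `ν(Σ(ℂ))` form a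
finite set with exactly `28` elements; and the `ι^*`-invariant subspace of `H²(X(ℂ); ℂ)` has complex
dimension `15`.  Verbatim: "Let `X` be a Hyperkähler manifold of `K3^[2]`-type with a symplectic
involution `φ`. Then […] the fixed locus `X^φ` consists of 28 isolated points and one K3 surface.
Moreover the lattice `T_φ(X)` has rank 15."
[cite: Mongardi2011, Thm. 4.1, Thm. 5.2 and Def. 3.1] -/
def Mongardi2011_symplecticInvolution_fixedLocus : Prop :=
  ∀ (X : Motives.SchemeOver ℂ), Motives.IsSmoothProjective 4 X → IsOfK3HilbertSquareType X →
    ∀ (ι : X ⟶ X), ι ≫ ι = 𝟙 X → ι ≠ 𝟙 X →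
      (∀ τ : HodgeTheory.complexBetti X 2, HodgeTheory.IsOfHodgeType 4 X 2 2 0 τ →
        HodgeTheory.complexBetti.map ι 2 τ = τ) →
      (∃ (F : Motives.SchemeOver ℂ) (ν : F ⟶ X),
        Surfaces.IsK3Surface F ∧ AlgebraicGeometry.IsClosedImmersion ν.left ∧ ν ≫ ι = ν ∧
        ∃ P : Finset (Motives.ComplexPoints X), P.card = 28 ∧
          {x : Motives.ComplexPoints X |
              Motives.AlgPoints.mapContinuous (L := ℂ) ι x = x ∧
                x ∉ Set.range (Motives.AlgPoints.mapContinuous (L := ℂ) ν)} = ↑P) ∧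
      Module.finrank ℂ
          (LinearMap.ker ((HodgeTheory.complexBetti.map ι 2).hom - LinearMap.id)) = 15

end Literature.AlgebraicGeometry.Hyperkaehler

/-! ## Appended 2026-08-16 (prover seat prover-line-stmt-HodgeConjecture-13674-c1-0, line lead of crux
stmt-HodgeConjecture-13674 `NikulinTwinTransport.TwinSimilitudeAlgebraic`, line `hyperkaehler-nikulin-anchors`,
facts F1–F2 of `Cruxes/TwinSimilitudeAlgebraic/Lines/hyperkaehler_nikulin_anchors.lean` reshape r2):
# the period map of `K3^{[2]}`-type fourfolds WITH a symplectic involution, and the restriction to the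
# fixed K3 surface — NAMED FACTS

Sources READ (materialised texts): C. Camere, A. Garbagnati, G. Kapustka, M. Kapustka, *Generalized
Nikulin surfaces and irreducible symplectic fourfolds*, arXiv:2607.00130, §2.3 (pp. 5–6: the lattice
involution `I`, the moduli space `M_{K3^{[2]},I}` and its period map `P_{K3^{[2]},I}` to
`D_{Λ^I} = {x ∈ ℙ(Λ^I ⊗ ℂ) | q(x) = 0, B(x, x̄) > 0}`), §4 proof of Thm. 3.1 (p. 9: "hence by the Torelli
theorem for manifolds of `K3^{[2]}`-type there exists a marked `(X, φ) ∈ M_{K3^{[2]},I}` with `X` of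
`K3^{[2]}`-type endowed with a symplectic involution `σ` such that `φ ∘ σ^* = I ∘ φ`"), §5.2 Lemma 5.5
(p. 11), Thm. 5.12 and its proof (pp. 13–14: "`f(T_Y^{−4} ⊗ ℚ) = ν^*(H²(X, ℤ)^{ι^*}(2)) ⊗ ℚ`",
"`B_Y(α, β) = ¼⟨f(α), f(β)⟩_F`"); the same authors, *Projective orbifolds of Nikulin type*, Algebra
Number Theory 18 (2024) (arXiv:2104.09234), Prop. 3.17 of the arXiv version (= Prop. 3.16 as cited in
arXiv:2607.00130) and its proof (p. 17: "the restriction `ν^*|_{T_X ⊗ ℚ}` is injective […] the image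
`N` of `ν^*|_{T_X ⊗ ℚ}` is exactly `T_S ⊗ ℚ` […] `⟨ν^*x, ν^*y⟩_S = ⟨μ_{[S]}(x), y⟩_X = x.y.[S]`"),
Lemma 4.3 ("`(H|_W)² = 2q(H)`"); G. Mongardi, arXiv:1107.2854, Thm. 4.1, Thm. 5.2, Cor. 5.3 (p. 10: "we
can always choose a marking of `(X, φ)` such that the induced action of `φ` on `L` is given by leaving
`(−2) ⊕ U³` invariant and exchanging the two remaining `E₈(−1)`"); G. Mongardi, Math. Z. 282 (2016)
(arXiv:1405.3232), Thm. 4.1 and Lemma 3.5; E. Markman, *A survey of Torelli and monodromy results*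
(2011), Thm. 1.3 (Hodge-theoretic Torelli); D. Huybrechts, Invent. Math. 135 (1999), Thm. 8.1
(surjectivity of the period map) and Thm. 3.11 (projectivity criterion).

Rendering (tree carriers).  A BEAUVILLE–BOGOMOLOV MARKING of a smooth projective `K3^{[2]}`-type
fourfold `X` is rendered by the six clauses `MarkedK3Sq[X, φ, P, z]` (local notation, the `K3^{[2]}`
analogue of the marking clauses of `Surfaces.Huybrechts_K3_marking_exists`): `P` an integral generator
of `H⁸(X(ℂ); ℂ)`; `φ : H²(X(ℂ); ℂ) ≅ ℂ²³ = (Λ_{K3} ⊕ ⟨−2⟩) ⊗ ℂ` identifying integral classes with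
`ℤ²³`; the FUJIKI RELATION `a⁴ = 3 · q(φa)² · P` for `q = k3HilbertForm 2` (Beauville 1983 §9, Fujiki
1987: `∫ α⁴ = 3 q(α)²`; together with integrality it pins `q ∘ φ` to the Beauville–Bogomolov form —
the sign being fixed by the signature `(3, 20)` — and `P` to the complex orientation class, so no
orientation datum is needed); `φ⁻¹ z` spans `H^{2,0}`; `H^{1,1} = ⟨z, z̄⟩^{⊥_q}` (Beauville 1983 §8
Thm. 5: `q`-orthogonality of the Hodge decomposition); `q(z) = 0 < q(z̄, z)`.  The TRANSCENDENTAL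
SPACE is rendered lattice-side: `Tr₂[w ; z]` says that `w ∈ ℂ²³` is `q`-orthogonal to every rational
vector `q`-orthogonal to `z`, i.e. `w ∈ T(z)_ℚ ⊗ ℂ` with `T(z)_ℚ := (z^⊥ ∩ ℚ²³)^⊥` — under the marking
`T(X)_ℚ ⊗ ℂ`, `T(X)_ℚ` being "the smallest rational Hodge substructure of `H²(X, ℚ)` such that
`T_X ⊗ ℂ` contains `ω_X`" (CGKK 2023, proof of Prop. 3.17); `Tr[w ; x]` is the same for the K3 lattice.
A SYMPLECTIC involution is `ι ≫ ι = 𝟙`, `ι ≠ 𝟙`, `ι^*` fixing the `(2,0)`-classes of `H²`, as in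
`Mongardi2011_symplecticInvolution_fixedLocus` above.  The lattice involution `I` (swap of the two
`E₈(−1)` blocks of `Λ_{K3}`, identity on `U³` and on `δ`) is `Sum.map Surfaces.k3BlockSwap id` on
`K3HilbertIndex = K3Index ⊕ Unit`; its invariant sublattice is Mongardi's `U³ ⊕ E₈(−2) ⊕ ⟨−2⟩`, its
co-invariant lattice `E₈(−2)` (Mongardi 2012 Thm. 5.2).

What is NOT here: the `28` isolated fixed points (above); the lattice-theoretic uniqueness statements;
the non-projective periods of `D_{Λ^I}` (the tree's carriers are schemes); any proof.
-/

namespace Literature.AlgebraicGeometry.Hyperkaehler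

open Literature.AlgebraicTopology.SingularHomology

/-- `MarkedK3[S, η, p, x]`: the six K3 marking clauses, VERBATIM those of
`Surfaces.Huybrechts_K3_marking_exists` (integral generator `p` of `H⁴`, `η` identifies integral classes
with `ℤ²²`, `a ∪ b = (ηa.ηb) p`, `η⁻¹ x` spans the `(2,0)`-classes). Local notation only. -/
local notation3 (prettyPrint := false) "MarkedK3[" S ", " η ", " p ", " x "]" =>
  (HodgeTheory.IsIntegralClass p ∧
    (∀ q : HodgeTheory.complexBetti S (2 * 2), HodgeTheory.IsIntegralClass q → ∃ n : ℤ, q = n • p) ∧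
    (∀ c : HodgeTheory.complexBetti S (2 * 1),
        HodgeTheory.IsIntegralClass c ↔ ∃ v : Surfaces.K3Index → ℤ, η c = fun i => (v i : ℂ)) ∧
    (∀ a b : HodgeTheory.complexBetti S (2 * 1),
        cupProduct (rfl : 2 * 1 + 2 * 1 = 2 * 2) a b = Surfaces.k3Form (η a) (η b) • p) ∧
    HodgeTheory.IsOfHodgeType 2 S (2 * 1) 2 0 (LinearEquiv.symm η x) ∧
    (∀ τ : HodgeTheory.complexBetti S (2 * 1),
        HodgeTheory.IsOfHodgeType 2 S (2 * 1) 2 0 τ → ∃ t : ℂ, τ = t • LinearEquiv.symm η x))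

/-- `MarkedK3Sq[X, φ, P, z]`: a BEAUVILLE–BOGOMOLOV MARKING of a smooth projective fourfold `X` of
`K3^{[2]}`-type with period `z ∈ (Λ_{K3} ⊕ ⟨−2⟩) ⊗ ℂ` (module docstring of this section): (m1) `P` is
an integral generator of `H⁸(X(ℂ); ℂ)`; (m2) `φ` identifies the integral classes of `H²(X(ℂ); ℂ)` with
`ℤ²³`; (m3) Fujiki relation `a⁴ = 3 · q(φ a)² · P`, `q = k3HilbertForm 2`; (m4) `φ⁻¹ z` spans the
`(2,0)`-classes; (m5) the `(1,1)`-classes are the `q`-orthogonal of `z` and `z̄`; (m6)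
`q(z) = 0 < q(z̄, z)`. Local notation only. [cite: Beauville1983, §8 Thm. 5 and §9 Lemme 1, Rem. 1]
[cite: Huybrechts1999, §1.9 and §1.11] -/
local notation3 (prettyPrint := false) "MarkedK3Sq[" X ", " φ ", " P ", " z "]" =>
  ((HodgeTheory.IsIntegralClass P ∧
      ∀ Q : HodgeTheory.complexBetti X (2 * 4), HodgeTheory.IsIntegralClass Q → ∃ n : ℤ, Q = n • P) ∧
    (∀ c : HodgeTheory.complexBetti X 2,
        HodgeTheory.IsIntegralClass c ↔ ∃ v : K3HilbertIndex → ℤ, φ c = fun i => (v i : ℂ)) ∧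
    (∀ a : HodgeTheory.complexBetti X 2,
        HodgeTheory.cupPowTwo a 4 = ((3 : ℂ) * (k3HilbertForm 2 (φ a) (φ a)) ^ 2) • P) ∧
    (HodgeTheory.IsOfHodgeType 4 X 2 2 0 (LinearEquiv.symm φ z) ∧
      ∀ τ : HodgeTheory.complexBetti X 2, HodgeTheory.IsOfHodgeType 4 X 2 2 0 τ →
        ∃ t : ℂ, τ = t • LinearEquiv.symm φ z) ∧
    (∀ c : HodgeTheory.complexBetti X 2, HodgeTheory.IsOfHodgeType 4 X 2 1 1 c ↔
        (k3HilbertForm 2 (φ c) z = 0 ∧ k3HilbertForm 2 (φ c) (star z) = 0)) ∧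
    (k3HilbertForm 2 z z = 0 ∧ 0 < (k3HilbertForm 2 (star z) z).re))

/-- `Tr₂[w ; z]`: `w ∈ ℂ²³` lies in `T(z)_ℚ ⊗ ℂ`, `T(z)_ℚ := (z^⊥ ∩ ℚ²³)^⊥` (the complexified rational
transcendental space of the period `z`; under a marking, `T(X)_ℚ ⊗ ℂ`). Local notation only.
[cite: CamereEtAl2023, Prop. 3.16 (proof)] [cite: Huybrechts2016K3, Ch. 3 Def. 2.5 and Lemma 3.1] -/
local notation3 (prettyPrint := false) "Tr₂[" w " ; " z "]" =>
  (∀ v : K3HilbertIndex → ℚ, k3HilbertForm 2 (fun i => ((v i : ℚ) : ℂ)) z = 0 →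
    k3HilbertForm 2 (fun i => ((v i : ℚ) : ℂ)) w = 0)

/-- `Tr[w ; x]`: the same for the K3 lattice `Λ_{K3} ⊗ ℂ = ℂ²²` and a K3 period `x`. Local notation only.
[cite: Huybrechts2016K3, Ch. 3 Def. 2.5 and Lemma 3.1] -/
local notation3 (prettyPrint := false) "Tr[" w " ; " x "]" =>
  (∀ v : Surfaces.K3Index → ℚ, Surfaces.k3Form (fun i => ((v i : ℚ) : ℂ)) x = 0 →
    Surfaces.k3Form (fun i => ((v i : ℚ) : ℂ)) w = 0)

/-- **F1 — REALISATION (surjectivity of the period map of `K3^{[2]}`-type fourfolds WITH A SYMPLECTIC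
INVOLUTION, on projective periods).**  Camere–Garbagnati–Kapustka–Kapustka 2026, §2.3: "a manifold of
`K3^{[2]}`-type admits a symplectic involution if and only if `E₈(−2)` is primitively embedded in its
Néron–Severi lattice […] the action induced by a symplectic involution on the second cohomology group is
essentially unique, see [Mon]. […] Let `I ∈ O(Λ_{K3^{[2]}})` be the involution which switches the two
`E₈(−1)` summands […] `M_{K3^{[2]},I}` the coarse moduli space of marked pairs `(X, φ)` such that […]
there exists a symplectic involution `ι ∈ Aut(X)` satisfying `φ ∘ ι^* ∘ φ⁻¹ = I`. The period map is
the holomorphic map `P_{K3^{[2]},I} : M_{K3^{[2]},I} → D_{Λ^I} := {x ∈ ℙ(Λ^I ⊗ ℂ) | q(x) = 0, B(x, x̄) > 0}`",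
and §4 (proof of Thm. 3.1, p. 9): "`p` still satisfies `q(p) = 0` and `B(p, p̄) > 0`, hence by the
Torelli theorem for manifolds of `K3^{[2]}`-type there exists a marked `(X, φ) ∈ M_{K3^{[2]},I}` with `X`
of `K3^{[2]}`-type endowed with a symplectic involution `σ` such that `φ ∘ σ^* = I ∘ φ`" (the ingredients:
surjectivity of the period map, Huybrechts 1999 Thm. 8.1; `E₈(−2)` contains no wall divisor and
`I ∈ O⁺ = Mon²`, Mongardi 2016 Thm. 4.1 / 2012 Cor. 5.3; Markman's Hodge-theoretic Torelli; projectivity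
from a positive integral `(1,1)`-class, Huybrechts 1999 Thm. 3.11).  Rendering (tree carriers): for
every `z ∈ (Λ_{K3} ⊕ ⟨−2⟩) ⊗ ℂ` INVARIANT under the block swap `I = k3BlockSwap ⊕ id`, with `q(z) = 0`,
`q(z̄, z) > 0` and a positive integral vector orthogonal to `z` (PROJECTIVE periods), there is a smooth
projective fourfold `X` of `K3^{[2]}`-type (`IsOfK3HilbertSquareType`) with an involution `ι ≠ 𝟙`
fixing the `(2,0)`-classes of `H²` (symplectic), a BBF-marking `(φ, P)` of period `z`
(`MarkedK3Sq[X, φ, P, z]`) in which `ι^*` is `I`: `φ(ι^* c) = φ(c) ∘ I`.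
[cite: CamereEtAl2026, §2.3 and §4 (proof of Thm. 3.1)] [cite: Mongardi2011, Cor. 5.3 and Thm. 5.2]
[cite: Mongardi2016, Thm. 4.1 and Lemma 3.5] [cite: Markman2011Survey, Thm. 1.3] [cite: Huybrechts1999, Thm. 8.1 and Thm. 3.11] -/
def CamereEtAl2026_symplecticInvolution_periodSurjective : Prop :=
  ∀ z : K3HilbertIndex → ℂ,
    (∀ i, z (Sum.map Surfaces.k3BlockSwap id i) = z i) →
    k3HilbertForm 2 z z = 0 → 0 < (k3HilbertForm 2 (star z) z).re →
    (∃ u : K3HilbertIndex → ℤ, k3HilbertForm 2 (fun i => (u i : ℂ)) z = 0 ∧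
        0 < ∑ i, ∑ j, u i * k3HilbertGram 2 i j * u j) →
    ∃ (X : Motives.SchemeOver ℂ) (ι : X ⟶ X) (φ : HodgeTheory.complexBetti X 2 ≃ₗ[ℂ] (K3HilbertIndex → ℂ))
      (P : HodgeTheory.complexBetti X (2 * 4)),
      Motives.IsSmoothProjective 4 X ∧ IsOfK3HilbertSquareType X ∧ ι ≫ ι = 𝟙 X ∧ ι ≠ 𝟙 X ∧
      (∀ τ : HodgeTheory.complexBetti X 2, HodgeTheory.IsOfHodgeType 4 X 2 2 0 τ →
          HodgeTheory.complexBetti.map ι 2 τ = τ) ∧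
      MarkedK3Sq[X, φ, P, z] ∧
      (∀ c : HodgeTheory.complexBetti X 2,
        φ (HodgeTheory.complexBetti.map ι 2 c) = fun i => φ c (Sum.map Surfaces.k3BlockSwap id i))

/-- **F2 — THE FIXED K3 SURFACE AND THE RESTRICTION MAP (doubling).**  Mongardi 2012 Thm. 4.1: "Let `X`
be a Hyperkähler manifold of `K3^{[2]}`-type with a symplectic involution `φ`. Then […] the fixed locus
`X^φ` consists of 28 isolated points and one K3 surface"; Camere–Garbagnati–Kapustka–Kapustka 2023,
Prop. 3.16 (arXiv Prop. 3.17) and its proof: for the fixed K3 `ν : S ↪ X`, "the restriction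
`ν^*|_{T_X ⊗ ℚ}` is injective […] the image […] is exactly `T_S ⊗ ℚ` […] `⟨ν^*x, ν^*y⟩_S = ⟨μ_{[S]}(x), y⟩_X`",
Lemma 4.3: "`(H|_W)² = 2q(H)`"; CGKK 2026 Lemma 5.5 and Thm. 5.12 (proof): "`f(T_Y^{−4} ⊗ ℚ) =
ν^*(H²(X, ℤ)^{ι^*}(2)) ⊗ ℚ`", i.e. ON THE INVARIANT PART — which contains `T(X)` — `ν^*` MULTIPLIES THE
BEAUVILLE–BOGOMOLOV FORM BY `2` (at the natural pair `(S^{[2]}, ι_S^{[2]})`, `F = S̃/ι_S`: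
`⟨ν^*i(a), ν^*i(b)⟩ = ⟨β^*a, β^*b + ι_S^*β^*b⟩ = 2(a.b)` for invariant `a, b`, `ν^*δ = ½ΣEᵢ` of square
`−4 = 2q(δ)`; constant on the deformation class).  Rendering: for `X` smooth projective of
`K3^{[2]}`-type, an involution `ι ≠ 𝟙` fixing the `(2,0)`-classes, and a BBF-marking `(φ, P, z)`, there
are a (projective) K3 surface `F` and a closed immersion `ν : F ⟶ X` with `ν ≫ ι = ν` such that for
every marking `(η, p_F, x_F)` of `F`: (a) `ν^*a ∪ ν^*b = (2 · q(φa, φb)) · p_F` for all `a, b` in the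
complexified rational transcendental space of `z`; (b) `ν^*` maps that space into, and (c) onto, the
complexified rational transcendental space of `x_F`.
[cite: Mongardi2011, Thm. 4.1] [cite: CamereEtAl2023, Prop. 3.16 and Lemma 4.3]
[cite: CamereEtAl2026, Lemma 5.5, Thm. 5.12 and Thm. 1.2] -/
def CamereEtAl2023_fixedK3_restriction : Prop :=
  ∀ (X : Motives.SchemeOver ℂ), Motives.IsSmoothProjective 4 X → IsOfK3HilbertSquareType X →
    ∀ (ι : X ⟶ X), ι ≫ ι = 𝟙 X → ι ≠ 𝟙 X →
      (∀ τ : HodgeTheory.complexBetti X 2, HodgeTheory.IsOfHodgeType 4 X 2 2 0 τ →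
          HodgeTheory.complexBetti.map ι 2 τ = τ) →
      ∀ (φ : HodgeTheory.complexBetti X 2 ≃ₗ[ℂ] (K3HilbertIndex → ℂ))
        (P : HodgeTheory.complexBetti X (2 * 4)) (z : K3HilbertIndex → ℂ), MarkedK3Sq[X, φ, P, z] →
        ∃ (F : Motives.SchemeOver ℂ) (ν : F ⟶ X), Surfaces.IsK3Surface F ∧
          AlgebraicGeometry.IsClosedImmersion ν.left ∧ ν ≫ ι = ν ∧
          ∀ (η : HodgeTheory.complexBetti F (2 * 1) ≃ₗ[ℂ] (Surfaces.K3Index → ℂ))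
            (pF : HodgeTheory.complexBetti F (2 * 2)) (xF : Surfaces.K3Index → ℂ),
            MarkedK3[F, η, pF, xF] →
            (∀ a b : HodgeTheory.complexBetti X 2, Tr₂[φ a ; z] → Tr₂[φ b ; z] →
                cupProduct (rfl : 2 * 1 + 2 * 1 = 2 * 2)
                  (HodgeTheory.complexBetti.map ν (2 * 1) a) (HodgeTheory.complexBetti.map ν (2 * 1) b) =
                  ((2 : ℂ) * k3HilbertForm 2 (φ a) (φ b)) • pF) ∧
            (∀ a : HodgeTheory.complexBetti X 2, Tr₂[φ a ; z] →
                Tr[η (HodgeTheory.complexBetti.map ν (2 * 1) a) ; xF]) ∧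
            (∀ y : HodgeTheory.complexBetti F (2 * 1), Tr[η y ; xF] →
                ∃ a : HodgeTheory.complexBetti X 2, Tr₂[φ a ; z] ∧
                  HodgeTheory.complexBetti.map ν (2 * 1) a = y)

end Literature.AlgebraicGeometry.Hyperkaehler

end
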